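import Summits.ResolutionOfSingularities.ResolutionOfSingularities.Theorems.FrobeniusClosingPatchingRelPerfectChartTransversalValues
import Summits.ResolutionOfSingularities.ResolutionOfSingularities.Theorems.FrobeniusClosingPatchingRelPerfectConeMemberLevelThree
import HarnessLib

/-!
# Crux `PatchingRelPerfect` (stmt-ResolutionOfSingularities-16161), chain w52 — rung toolkit:
# the THREE-LETTER STEP (hyperplane `c`, letters `ℓ`, `o`): blowing up `V(c, ℓ)` reproduces the
# hypotheses on the `ℓ`-chart, for BOTH next centres `V(c', ℓ')` and `V(c', o')`

[OURS · L1 W5.2 · rung tool] The local machinery behind the contact-migration members of kernel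
sentence (iii) (this seat's HAND-NOTE-nongraded-A2.md: after the vertex blow-up the residual of
`(x₀x₁ + x₂² + x₃³) + 𝔪⁴` is `w³ · (c, w²h) · (c, w³h²)` — an order-one residual along the regular
hypersurface `V(c)` plus monomials in two snc letters `w, h`, principalised by five blow-ups of the
codimension-two regular centres `V(c, w)`, `V(c′, w)`, `V(c″, h)`, …).  Abstract STEP: `R` a regular
domain with three elements `c` (the hyperplane), `ℓ` (the letter blown up), `o` (the other letter)
such that `(c, ℓ)` and `(c, o)` are quasi-regular pairs with regular integral quotients, `R/(c)` is
regular and integral, `R/(ℓ)`, `R/(o)` integral, `R/(c, ℓ, o)` integral, `ℓ ∉ (c, o)`, `o ∉ (c, ℓ)`.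
On the `ℓ`-chart `D` of `Bl_{(c,ℓ)} Spec R` put `c' = c/ℓ` (chart generator), `ℓ' = ℓ/1` (exceptional
parameter), `o' = o/1`.  PROVED — every hypothesis again, for `(D; c', ℓ', o')`:

* `step_isRegularRing`, `step_isDomain` (the chart); `step_isQuasiRegular_c'ℓ'`, `step_isQuasiRegular_c'o'`
  (bricks 1/2: `…ChartStrictExceptional`, `…ChartTransversal`); `step_isRegularRing_quot_c'ℓ'`,
  `step_isDomain_quot_c'ℓ'` (chart family); `step_isRegularRing_quot_c'o'`, `step_isDomain_quot_c'o'`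
  (brick 3 `…ChartTransversalPair`); `step_isRegularRing_quot_c'`, `step_isDomain_quot_c'`,
  `step_isDomain_quot_ℓ'`, `step_isDomain_quot_o'`; `step_isDomain_quot_triple`; `step_ℓ'_notMem`,
  `step_o'_notMem` (brick 4 `…ChartTransversalValues`).

So the step can be ITERATED with either letter next (the `o`-step is this lemma with `(ℓ, o)`
swapped, its hypotheses being among the outputs).  Arbitrary regular domains; nothing here is a
statement of the manuscript under review.

## References

* The Stacks Project, Tags 0804, 07Z3, 0BIQ. [StacksProject]
* U. Görtz, T. Wedhorn, *Algebraic Geometry I*, 2nd ed. 2020, Prop. 13.96 (2). [GortzWedhorn2020]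
* H. Matsumura, *Commutative Ring Theory*, CUP 1986, Thm. 16.2 (i). [Matsumura1987]
-/

-- `Summit.<Summit>.<Sub>.Theorems` with `Sub = Summit` (single-conjunct summit, D-0017)
set_option linter.dupNamespace false

noncomputable section

open CategoryTheory CategoryTheory.Limits AlgebraicGeometry Literature.AlgebraicGeometry.Resolution
open IsLocalRing

namespace Summit.ResolutionOfSingularities.ResolutionOfSingularities.Theorems

namespace ConeRung

universe u

section Step

variable {R : Type u} [CommRing R] (c ℓ o : R)
  (hcl : IsQuasiRegular (Fin.cons c (fun _ : Fin 1 => ℓ) : Fin 2 → R))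

local notation3 "cc" => (Fin.cons c (fun _ : Fin 1 => ℓ) : Fin 2 → R)
local notation3 "II" => Ideal.span (Set.range (Fin.cons c (fun _ : Fin 1 => ℓ) : Fin 2 → R))
/-- the `ℓ`-chart and the new letters -/
local notation3 "D" => chartRing cc (Fin.succ 0)
local notation3 "ψ" => chartBase cc (Fin.succ 0)
local notation3 "ℓ'" => chartBase cc (Fin.succ 0) (cc (Fin.succ 0))
local notation3 "c'" => chartGen cc (Fin.succ 0) 0
local notation3 "o'" => chartBase cc (Fin.succ 0) o

/-- `(c, ℓ) = (range cc)` as ideals. [folklore] -/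
theorem step_span_pair_eq : Ideal.span {c, ℓ} = II := by
  rw [Fin.range_cons c (fun _ : Fin 1 => ℓ), Set.range_const]

/-- `ψ ℓ = ℓ'` (the exceptional parameter is the image of the blown-up letter). [folklore] -/
theorem step_chartBase_ℓ : ψ ℓ = ℓ' := rfl

include hcl in
/-- The chart is a regular ring. [cite: Liu2002, Thm. 8.1.19 (a)] -/
theorem step_isRegularRing [IsRegularRing R] [IsRegularRing (R ⧸ Ideal.span {c, ℓ})] :
    IsRegularRing D := by
  haveI : IsRegularRing (R ⧸ II) := by rw [← step_span_pair_eq]; infer_instance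
  exact isRegularRing_blowupChart cc (Fin.succ 0) hcl

/-- The chart is a domain. [cite: StacksProject, Tag 0804] -/
theorem step_isDomain [IsDomain R] (hℓ0 : ℓ ≠ 0) : IsDomain D :=
  strictExc_isDomain_chart c (fun _ : Fin 1 => ℓ) 0 (by rwa [Fin.cons_succ])

include hcl in
/-- `D ⧸ (c', ℓ')` is a regular ring (`≅ R/(c, ℓ)`). [cite: StacksProject, Tag 0BIQ] -/
theorem step_isRegularRing_quot_c'ℓ' [IsRegularRing (R ⧸ Ideal.span {c, ℓ})] :
    IsRegularRing (D ⧸ Ideal.span {c', ℓ'}) := by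
  haveI : IsRegularRing (R ⧸ II) := by rw [← step_span_pair_eq]; infer_instance
  have h := isRegularRing_quot_cons_chartGen cc (Fin.succ 0)
    (fun _ : Fin 1 => (⟨0, (Fin.succ_ne_zero 0).symm⟩ : {l : Fin 2 // l ≠ Fin.succ 0})) hcl
  have heq : Ideal.span (Set.range (Fin.cons ℓ' (fun _ : Fin 1 => c') : Fin 2 → D)) =
      Ideal.span {c', ℓ'} := by
    rw [span_range_cthree ℓ' c', Ideal.span_insert, Ideal.span_insert, sup_comm]
  rw [heq] at h
  exact h

include hcl in
/-- `D ⧸ (c', ℓ')` is a domain (`≅ R/(c, ℓ)`). [cite: StacksProject, Tag 0BIQ] -/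
theorem step_isDomain_quot_c'ℓ' [IsDomain (R ⧸ Ideal.span {c, ℓ})] :
    IsDomain (D ⧸ Ideal.span {c', ℓ'}) := by
  haveI : IsDomain (R ⧸ II) := by rw [← step_span_pair_eq]; infer_instance
  haveI : IsDomain (R ⧸ (II ⊔ ⊥)) := by rw [sup_bot_eq]; infer_instance
  let ε := chartStageEquiv cc (Fin.succ 0) ⊥ {0} hcl (by simp)
  have hstage : chartStageIdeal cc (Fin.succ 0) ⊥ {0} = Ideal.span {c', ℓ'} := by
    rw [chartStageIdeal, Ideal.map_bot, sup_bot_eq, Set.image_singleton, Ideal.span_insert,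
      sup_comm]
  rw [hstage] at ε
  exact MulEquiv.isDomain _ ε.symm.toMulEquiv

include hcl in
/-- `D ⧸ (c')` is a domain (brick 1: the strict transform of `V(c)`). [cite: GortzWedhorn2020, Prop. 13.96 (2)] -/
theorem step_isDomain_quot_c' [IsDomain (R ⧸ Ideal.span {c, ℓ})] [IsDomain (R ⧸ Ideal.span {c})]
    (hℓc : ℓ ∉ Ideal.span {c}) : IsDomain (D ⧸ Ideal.span {c'}) := by
  haveI : IsDomain (R ⧸ II) := by rw [← step_span_pair_eq]; infer_instance
  exact strictExc_isDomain_quot c (fun _ : Fin 1 => ℓ) 0 hcl hℓc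

include hcl in
/-- `D ⧸ (c')` is a regular ring (brick 2: `≅ R/(c)`). [cite: GortzWedhorn2020, Prop. 13.96 (2)] -/
theorem step_isRegularRing_quot_c' [IsDomain (R ⧸ Ideal.span {c, ℓ})] [IsDomain (R ⧸ Ideal.span {c})]
    [IsRegularRing (R ⧸ Ideal.span {c})] (hℓc : ℓ ∉ Ideal.span {c}) :
    IsRegularRing (D ⧸ Ideal.span {c'}) := by
  haveI : IsDomain (R ⧸ II) := by rw [← step_span_pair_eq]; infer_instance
  exact strictExc_isRegularRing_quot_pair c ℓ hcl hℓc

include hcl in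
/-- `D ⧸ (ℓ')` is a domain (the exceptional divisor chart). [cite: StacksProject, Tag 0BIQ] -/
theorem step_isDomain_quot_ℓ' [IsDomain (R ⧸ Ideal.span {c, ℓ})] : IsDomain (D ⧸ Ideal.span {ℓ'}) := by
  haveI : IsDomain (R ⧸ II) := by rw [← step_span_pair_eq]; infer_instance
  exact isDomain_chartRing_quot_span cc (Fin.succ 0) hcl

include hcl in
/-- `D ⧸ (o')` is a domain (brick 1: the transversal hypersurface). [cite: GortzWedhorn2020, Prop. 13.96 (2)] -/
theorem step_isDomain_quot_o' [IsDomain (R ⧸ Ideal.span {c, ℓ})] [IsDomain (R ⧸ Ideal.span {o})]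
    (ho : o ∉ Ideal.span {c, ℓ}) (hℓo : ℓ ∉ Ideal.span {o}) : IsDomain (D ⧸ Ideal.span {o'}) := by
  haveI : IsDomain (R ⧸ II) := by rw [← step_span_pair_eq]; infer_instance
  exact transv_isDomain_quot c (fun _ : Fin 1 => ℓ) 0 o hcl (by rwa [← step_span_pair_eq]) hℓo

include hcl in
/-- `D ⧸ (c', o')` is a regular ring (brick 3: `≅ R/(c, o)`). [cite: GortzWedhorn2020, Prop. 13.96 (2)] -/
theorem step_isRegularRing_quot_c'o' [IsDomain (R ⧸ Ideal.span {c, ℓ})] [IsDomain (R ⧸ Ideal.span {c})]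
    [IsRegularRing (R ⧸ Ideal.span {c, o})] (hℓc : ℓ ∉ Ideal.span {c}) :
    IsRegularRing (D ⧸ Ideal.span {c', o'}) := by
  haveI : IsDomain (R ⧸ II) := by rw [← step_span_pair_eq]; infer_instance
  exact transv_isRegularRing_quot_pair c ℓ o hcl hℓc

include hcl in
/-- `D ⧸ (c', o')` is a domain (brick 3). [cite: GortzWedhorn2020, Prop. 13.96 (2)] -/
theorem step_isDomain_quot_c'o' [IsDomain (R ⧸ Ideal.span {c, ℓ})] [IsDomain (R ⧸ Ideal.span {c})]
    [IsDomain (R ⧸ Ideal.span {c, o})] (hℓc : ℓ ∉ Ideal.span {c}) :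
    IsDomain (D ⧸ Ideal.span {c', o'}) := by
  haveI : IsDomain (R ⧸ II) := by rw [← step_span_pair_eq]; infer_instance
  exact transv_isDomain_quot_pair c ℓ o hcl hℓc

include hcl in
/-- `D ⧸ (c', ℓ', o')` is a domain (brick 4: triple transversality one level up).
[cite: StacksProject, Tag 0BIQ] -/
theorem step_isDomain_quot_triple [IsDomain (R ⧸ (Ideal.span {c, ℓ} ⊔ Ideal.span {o}))] :
    IsDomain (D ⧸ (Ideal.span {c', ℓ'} ⊔ Ideal.span {o'})) := by
  haveI : IsDomain (R ⧸ (II ⊔ Ideal.span {o})) := by rw [← step_span_pair_eq]; infer_instance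
  have h := transv_isDomain_quot_triple c ℓ o hcl
  have heq : Ideal.span {ℓ'} ⊔ Ideal.span {o'} ⊔ Ideal.span {c'} =
      Ideal.span {c', ℓ'} ⊔ Ideal.span {o'} := by
    rw [Ideal.span_insert, sup_comm (Ideal.span {c'}), sup_assoc, sup_comm (Ideal.span {o'}), ← sup_assoc]
  rw [heq] at h
  exact h

include hcl in
/-- `ℓ' ∉ (c', o')` (brick 4, `ℓ ∉ (c) + (o)`). [folklore] -/
theorem step_ℓ'_notMem [IsDomain (R ⧸ Ideal.span {c, ℓ})] [IsDomain (R ⧸ Ideal.span {c})]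
    (hℓc : ℓ ∉ Ideal.span {c}) (hℓ : ℓ ∉ Ideal.span {c, o}) : ℓ' ∉ Ideal.span {c', o'} := by
  haveI : IsDomain (R ⧸ II) := by rw [← step_span_pair_eq]; infer_instance
  have h := transv_chartBase_notMem_pair c ℓ o hcl hℓc (r := ℓ)
    (by rwa [← Ideal.span_insert])
  rwa [← Ideal.span_insert] at h

include hcl in
/-- `o' ∉ (c', ℓ')` (brick 4, `o ∉ (c, ℓ)`). [folklore] -/
theorem step_o'_notMem [Nontrivial (R ⧸ Ideal.span {c, ℓ})] (ho : o ∉ Ideal.span {c, ℓ}) :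
    o' ∉ Ideal.span {c', ℓ'} := by
  haveI : Nontrivial (R ⧸ II) := by rw [← step_span_pair_eq]; infer_instance
  have h := chartBase_notMem_span_pair_chartFamily c ℓ o hcl (by rwa [← step_span_pair_eq])
  rwa [sup_comm, ← Ideal.span_insert] at h

include hcl in
/-- **`(c', ℓ')` is quasi-regular** (weakly regular `[c', ℓ']`: `D` a domain, `D/(c')` a domain,
`ℓ' ∉ (c')`). [cite: Matsumura1987, Thm. 16.2 (i)] -/
theorem step_isQuasiRegular_c'ℓ' [IsDomain R] [IsDomain (R ⧸ Ideal.span {c, ℓ})]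
    [IsDomain (R ⧸ Ideal.span {c})] (hℓc : ℓ ∉ Ideal.span {c}) :
    IsQuasiRegular (Fin.cons c' (fun _ : Fin 1 => ℓ') : Fin 2 → D) := by
  haveI : IsDomain (R ⧸ II) := by rw [← step_span_pair_eq]; infer_instance
  exact strictExc_isQuasiRegular_pair c (fun _ : Fin 1 => ℓ) 0 hcl hℓc (g := ℓ') (r := ℓ) (n := 0)
    (by show ℓ' = ℓ' ^ 0 * ℓ'; ring) hℓc

include hcl in
/-- **`(c', o')` is quasi-regular** (weakly regular `[c', o']`: `o' ∉ (c')` as `o ∉ (c)`).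
[cite: Matsumura1987, Thm. 16.2 (i)] -/
theorem step_isQuasiRegular_c'o' [IsDomain R] [IsDomain (R ⧸ Ideal.span {c, ℓ})]
    [IsDomain (R ⧸ Ideal.span {c})] (hℓc : ℓ ∉ Ideal.span {c}) (hoc : o ∉ Ideal.span {c}) :
    IsQuasiRegular (Fin.cons c' (fun _ : Fin 1 => o') : Fin 2 → D) := by
  haveI : IsDomain (R ⧸ II) := by rw [← step_span_pair_eq]; infer_instance
  exact strictExc_isQuasiRegular_pair c (fun _ : Fin 1 => ℓ) 0 hcl hℓc (g := o') (r := o) (n := 0)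
    (by show o' = ℓ' ^ 0 * o'; ring) hoc

end Step

end ConeRung

end Summit.ResolutionOfSingularities.ResolutionOfSingularities.Theorems

end
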